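import Mathlib
import HarnessLib
import Summits.NavierStokesRegularity.NavierStokesRegularity.Theorems.PoloidalWindowDoorLrcModEntireJetCertPsatz

/-!
# Jet-certificate checker — SUBSTITUTION OF ONE LETTER at point level (`X_i := num / c`, denominators cleared, canonicalised, rescaled)

Cell pub-ns-dss, seat ns-crc-p1 gen 5 (Lean-certificate hand of the wall experiment `ns-wall-extremal`, arm C; PREREG-WALL-1 §C), 2026-08-28.
`--supports stmt-NavierStokesRegularity-19708` (wall W4 `PoloidalWindowRigidity`, instrument).  Generic real algebra on the tree's term lists
(`QMvPoly`); no Navier–Stokes content.  This is the arithmetic core of the transcript replayer `…JetCertPsatzElim` (pivot steps of a greedy exact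
elimination): at a real point where a law `c·X_i + R = 0` holds with `c ≠ 0`, every polynomial may be rewritten with `X_i := −R/c`; clearing
denominators by `c^d` multiplies values by `c(z)^d` (`ev_substQ`), so laws stay laws, pins stay pins, and (with an even `d` and a positive rescaling)
sign constraints keep their sign.

* `zeroAt`, `getD_zeroAt`, `ev_single`, `prod_pow_split`; `degIn`/`le_degIn`; `restIn`, `coeffIn`, **`ev_linear_split`** (a law of `i`-degree ≤ 1 is
  `X_i·coeffIn + restIn`); `substQ`, **`ev_substQ`**;
* `lexLt`, `minTerm`, `scaleMonic`, `scaleAbsMonic` (rescaling by the coefficient of the lexicographically smallest exponent list — Python's list order, so an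
  engine's mirror rescales identically; keeps the rationals of a long transcript small), `ev_scaleMonic`, `ev_scaleAbsMonic`;
* `substLaw` / `substSign` and **`ev_substLaw_eq_zero`**, **`ev_substLaw_ne_zero`**, **`ev_substSign_nonneg`**.
Data modules write their (large) identity systems with the tree's row encoding `…THCertDecode.decodePoly` (K2 LEAD g7, encoding of record).

WHAT THIS IS NOT: not a claim about Navier–Stokes and not a certificate. [folklore]
-/

noncomputable section

-- the summit and its single sub-problem share the name (CONVENTIONS §1), as in every Theorems file
set_option linter.dupNamespace false

namespace Summit.NavierStokesRegularity.NavierStokesRegularity.Theorems.PoloidalWindowDoorLrcModEntireJetCertPsatzSubst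

open _root_.Topology _root_.Filter Set
open Literature.Analysis.ValidatedNumerics Literature.Analysis.ValidatedNumerics.QMvPoly
open Literature.Analysis.Calculus.MvPoly
open Summit.NavierStokesRegularity.NavierStokesRegularity.Theorems.PoloidalWindowDoorLrcModEntireJetCertDefs
open Summit.NavierStokesRegularity.NavierStokesRegularity.Theorems.PoloidalWindowDoorLrcModEntireJetCertTree
open Summit.NavierStokesRegularity.NavierStokesRegularity.Theorems.PoloidalWindowDoorLrcModEntireJetCertFast2
open Summit.NavierStokesRegularity.NavierStokesRegularity.Theorems.PoloidalWindowDoorLrcModEntireJetCertGauge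
open Summit.NavierStokesRegularity.NavierStokesRegularity.Theorems.PoloidalWindowDoorLrcModEntireJetCertPsatz

variable {n : ℕ}

/-! ### One letter at a time: degree, linear coefficient, substitution -/

/-- Set the `i`-th exponent of an exponent list to `0` (no-op beyond the list's length). [folklore] -/
def zeroAt : List ℕ → ℕ → List ℕ
  | [], _ => []
  | _ :: m, 0 => 0 :: m
  | a :: m, i + 1 => a :: zeroAt m i

/-- Exponents of `zeroAt`. [folklore] -/
theorem getD_zeroAt : ∀ (m : List ℕ) (i j : ℕ), (zeroAt m i).getD j 0 = if j = i then 0 else m.getD j 0 := by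
  intro m
  induction m with
  | nil => intro i j; simp [zeroAt]
  | cons a m ih =>
    intro i j
    cases i with
    | zero =>
      cases j with
      | zero => simp [zeroAt]
      | succ j => simp [zeroAt]
    | succ i =>
      cases j with
      | zero => simp [zeroAt]
      | succ j => simp only [zeroAt, List.getD_cons_succ, ih i j]; simp

/-- Value of a one-term list. [folklore] -/
theorem ev_single (z : EuclideanSpace ℝ (Fin n)) (m : List ℕ) (a : ℚ) :
    ev n [(m, a)] z = (a : ℝ) * ∏ j : Fin n, z j ^ m.getD j 0 := by
  rw [ev, toFun_apply, QMvPoly.eval_toMv_cons]; simp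

/-- Splitting off the `i`-th letter of a monomial. [folklore] -/
theorem prod_pow_split (z : EuclideanSpace ℝ (Fin n)) (m : List ℕ) (i : Fin n) :
    (∏ j : Fin n, z j ^ m.getD j 0) = (∏ j : Fin n, z j ^ (zeroAt m i).getD j 0) * z i ^ m.getD i 0 := by
  have h : ∀ j : Fin n, z j ^ m.getD j 0 = z j ^ (zeroAt m i).getD j 0 * (if j = i then z i ^ m.getD i 0 else 1) := by
    intro j
    rw [getD_zeroAt]
    by_cases hj : j = i
    · subst hj; simp
    · have hj' : (j : ℕ) ≠ (i : ℕ) := fun e => hj (Fin.ext e)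
      simp [hj, hj']
  rw [Finset.prod_congr rfl fun j _ => h j, Finset.prod_mul_distrib, Finset.prod_ite_eq']
  simp

/-- Degree of a term list in the letter `i` (maximum exponent). [folklore] -/
def degIn (i : ℕ) (p : QMvPoly) : ℕ := p.foldr (fun t d => max (t.1.getD i 0) d) 0

/-- Every term's `i`-exponent is at most `degIn i p`. [folklore] -/
theorem le_degIn (i : ℕ) : ∀ (p : QMvPoly), ∀ t ∈ p, t.1.getD i 0 ≤ degIn i p := by
  intro p
  induction p with
  | nil => intro t ht; simp at ht
  | cons u q ih =>
    intro t ht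
    simp only [degIn, List.foldr_cons]
    rcases List.mem_cons.1 ht with rfl | ht
    · exact le_max_left _ _
    · exact le_trans (ih t ht) (le_max_right _ _)

/-- The terms free of `X_i`. [folklore] -/
def restIn (i : ℕ) (p : QMvPoly) : QMvPoly := p.filter fun t => t.1.getD i 0 = 0

/-- The coefficient of `X_i` (terms of `i`-exponent exactly `1`, with `X_i` removed). [folklore] -/
def coeffIn (i : ℕ) (p : QMvPoly) : QMvPoly := (p.filter fun t => t.1.getD i 0 = 1).map fun t => (zeroAt t.1 i, t.2)

/-- **A law linear in `X_i` splits as `X_i · coeffIn + restIn`** (at every point). [folklore] -/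
theorem ev_linear_split (z : EuclideanSpace ℝ (Fin n)) (i : Fin n) :
    ∀ p : QMvPoly, degIn i p ≤ 1 → ev n p z = z i * ev n (coeffIn i p) z + ev n (restIn i p) z := by
  intro p hp
  have hle := le_degIn (i : ℕ) p
  induction p with
  | nil => simp [coeffIn, restIn]
  | cons t q ih =>
    have hq : degIn i q ≤ 1 := by
      refine le_trans ?_ hp
      simp only [degIn, List.foldr_cons]; exact le_max_right _ _
    have ht : t.1.getD i 0 ≤ 1 := le_trans (hle t (by simp)) hp
    have ih' := ih hq (fun u hu => le_degIn (i : ℕ) q u hu)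
    rw [show t :: q = [t] ++ q from rfl, ev_append, ih']
    rcases Nat.le_one_iff_eq_zero_or_eq_one.1 ht with h0 | h1
    · -- the term is free of X_i
      have h0' : t.1[(i : ℕ)]?.getD 0 = 0 := by simpa [List.getD_eq_getElem?_getD] using h0
      have hc : coeffIn i ([t] ++ q) = coeffIn i q := by simp [coeffIn, h0']
      have hr : restIn i ([t] ++ q) = [t] ++ restIn i q := by simp [restIn, h0']
      rw [hc, hr, ev_append]; ring
    · -- the term is linear in X_i
      have h1' : t.1[(i : ℕ)]?.getD 0 = 1 := by simpa [List.getD_eq_getElem?_getD] using h1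
      have hc : coeffIn i ([t] ++ q) = [(zeroAt t.1 i, t.2)] ++ coeffIn i q := by simp [coeffIn, h1']
      have hr : restIn i ([t] ++ q) = restIn i q := by simp [restIn, h1']
      rw [hc, hr, ev_append, ev_single, ev_single, prod_pow_split z t.1 i, h1, pow_one]; ring

/-- **SUBSTITUTION `X_i := num / c` WITH DENOMINATORS CLEARED** to the power `d`: the term `a·X^m` (with `k = m_i`) becomes `a · X^{m[i↦0]} · num^k · c^(d−k)`. [folklore] -/
def substQ (i : ℕ) (num c : QMvPoly) (d : ℕ) (p : QMvPoly) : QMvPoly :=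
  (p.map fun t => QMvPoly.mul [(zeroAt t.1 i, t.2)] (QMvPoly.mul (powQ num (t.1.getD i 0)) (powQ c (d - t.1.getD i 0)))).flatten

/-- **SOUNDNESS OF THE SUBSTITUTION**: at a point with `c(z)·z_i = num(z)`, and when `d` bounds the `i`-degree, `(substQ p)(z) = c(z)^d · p(z)`. [folklore] -/
theorem ev_substQ (z : EuclideanSpace ℝ (Fin n)) (i : Fin n) (num c : QMvPoly) (hz : ev n c z * z i = ev n num z) :
    ∀ (p : QMvPoly) (d : ℕ), (∀ t ∈ p, t.1.getD i 0 ≤ d) → ev n (substQ i num c d p) z = ev n c z ^ d * ev n p z := by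
  intro p
  induction p with
  | nil => intro d _; simp [substQ]
  | cons t q ih =>
    intro d hd
    have hk : t.1.getD i 0 ≤ d := hd t (by simp)
    have hsplit : substQ i num c d (t :: q) =
        QMvPoly.mul [(zeroAt t.1 i, t.2)] (QMvPoly.mul (powQ num (t.1.getD i 0)) (powQ c (d - t.1.getD i 0))) ++ substQ i num c d q := by
      simp [substQ]
    rw [hsplit, ev_append, ih d (fun u hu => hd u (by simp [hu])), show t :: q = [t] ++ q from rfl, ev_append, ev_mul, ev_mul,
      ev_powQ, ev_powQ, ev_single, ev_single, prod_pow_split z t.1 i]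
    set k := t.1.getD i 0 with hk_def
    have hpow : ev n num z ^ k * ev n c z ^ (d - k) = ev n c z ^ d * z i ^ k := by
      rw [← hz, mul_pow, mul_assoc, mul_comm (z i ^ k), ← mul_assoc, ← pow_add, Nat.add_sub_cancel' hk]
    rw [mul_add]
    congr 1
    calc (t.2 : ℝ) * (∏ j : Fin n, z j ^ (zeroAt t.1 i).getD j 0) * (ev n num z ^ k * ev n c z ^ (d - k))
        = (t.2 : ℝ) * (∏ j : Fin n, z j ^ (zeroAt t.1 i).getD j 0) * (ev n c z ^ d * z i ^ k) := by rw [hpow]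
      _ = ev n c z ^ d * ((t.2 : ℝ) * ((∏ j : Fin n, z j ^ (zeroAt t.1 i).getD j 0) * z i ^ k)) := by ring

/-- Lexicographic «less than» on exponent lists (a proper prefix is smaller) — the same order as Python's list comparison, so that an engine's
mirror picks the same normalising term. [folklore] -/
def lexLt : List ℕ → List ℕ → Bool
  | [], [] => false
  | [], _ :: _ => true
  | _ :: _, [] => false
  | a :: l, b :: m => decide (a < b) || (a == b && lexLt l m)

/-- The term with the lexicographically smallest exponent list (first such term). [folklore] -/
def minTerm : QMvPoly → Option (List ℕ × ℚ)
  | [] => none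
  | t :: q => match minTerm q with
    | none => some t
    | some u => if lexLt u.1 t.1 then some u else some t

/-- RESCALE a law or pin by the inverse of its normalising coefficient (keeps the rationals small along a transcript; a no-op on a zero coefficient). [folklore] -/
def scaleMonic (p : QMvPoly) : QMvPoly :=
  match minTerm p with
  | none => p
  | some t => if t.2 = 0 then p else QMvPoly.smul t.2⁻¹ p

/-- RESCALE a sign constraint by a POSITIVE rational (the inverse absolute value of its normalising coefficient). [folklore] -/
def scaleAbsMonic (p : QMvPoly) : QMvPoly :=
  match minTerm p with
  | none => p
  | some t => if t.2 = 0 then p else QMvPoly.smul |t.2|⁻¹ p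

/-- `scaleMonic` multiplies the value by a non-zero rational. [folklore] -/
theorem ev_scaleMonic (p : QMvPoly) (z : EuclideanSpace ℝ (Fin n)) : ∃ κ : ℚ, κ ≠ 0 ∧ ev n (scaleMonic p) z = (κ : ℝ) * ev n p z := by
  unfold scaleMonic
  cases minTerm p with
  | none => exact ⟨1, one_ne_zero, by simp⟩
  | some t =>
    by_cases h : t.2 = 0
    · exact ⟨1, one_ne_zero, by simp [h]⟩
    · exact ⟨t.2⁻¹, inv_ne_zero h, by simp [h, ev_smul]⟩

/-- `scaleAbsMonic` multiplies the value by a positive rational. [folklore] -/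
theorem ev_scaleAbsMonic (p : QMvPoly) (z : EuclideanSpace ℝ (Fin n)) : ∃ κ : ℚ, 0 < κ ∧ ev n (scaleAbsMonic p) z = (κ : ℝ) * ev n p z := by
  unfold scaleAbsMonic
  cases minTerm p with
  | none => exact ⟨1, one_pos, by simp⟩
  | some t =>
    by_cases h : t.2 = 0
    · exact ⟨1, one_pos, by simp [h]⟩
    · exact ⟨|t.2|⁻¹, inv_pos.2 (abs_pos.2 h), by simp [h, ev_smul]⟩

/-- The substitution applied to a LAW or PIN: cleared to its own `i`-degree, canonicalised, rescaled (a no-op when `X_i` is absent). [folklore] -/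
def substLaw (i : ℕ) (num c : QMvPoly) (p : QMvPoly) : QMvPoly :=
  if degIn i p = 0 then p else scaleMonic (normalizeS (trimQ (substQ i num c (degIn i p) p)))

/-- The substitution applied to a SIGN constraint: cleared to an EVEN power and rescaled by a positive rational, so the sign is kept. [folklore] -/
def substSign (i : ℕ) (num c : QMvPoly) (p : QMvPoly) : QMvPoly :=
  if degIn i p = 0 then p else scaleAbsMonic (normalizeS (trimQ (substQ i num c (2 * ((degIn i p + 1) / 2)) p)))

/-- Laws stay laws under the substitution. [folklore] -/
theorem ev_substLaw_eq_zero (z : EuclideanSpace ℝ (Fin n)) (i : Fin n) (num c : QMvPoly) (hz : ev n c z * z i = ev n num z) {p : QMvPoly}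
    (hp : ev n p z = 0) : ev n (substLaw i num c p) z = 0 := by
  unfold substLaw
  split_ifs with hd
  · exact hp
  · obtain ⟨κ, -, hκ⟩ := ev_scaleMonic (normalizeS (trimQ (substQ i num c (degIn i p) p))) z
    rw [hκ, ev_normalizeS, ev_trimQ, ev_substQ z i num c hz p _ (le_degIn (i : ℕ) p), hp]; simp

/-- Pins stay pins under the substitution (the pivot coefficient being non-zero at the point). [folklore] -/
theorem ev_substLaw_ne_zero (z : EuclideanSpace ℝ (Fin n)) (i : Fin n) (num c : QMvPoly) (hz : ev n c z * z i = ev n num z)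
    (hc : ev n c z ≠ 0) {p : QMvPoly} (hp : ev n p z ≠ 0) : ev n (substLaw i num c p) z ≠ 0 := by
  unfold substLaw
  split_ifs with hd
  · exact hp
  · obtain ⟨κ, hκ0, hκ⟩ := ev_scaleMonic (normalizeS (trimQ (substQ i num c (degIn i p) p))) z
    rw [hκ, ev_normalizeS, ev_trimQ, ev_substQ z i num c hz p _ (le_degIn (i : ℕ) p)]
    exact mul_ne_zero (by exact_mod_cast hκ0) (mul_ne_zero (pow_ne_zero _ hc) hp)

/-- Sign constraints stay sign constraints under the substitution. [folklore] -/
theorem ev_substSign_nonneg (z : EuclideanSpace ℝ (Fin n)) (i : Fin n) (num c : QMvPoly) (hz : ev n c z * z i = ev n num z) {p : QMvPoly}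
    (hp : 0 ≤ ev n p z) : 0 ≤ ev n (substSign i num c p) z := by
  unfold substSign
  split_ifs with hd
  · exact hp
  · obtain ⟨κ, hκ0, hκ⟩ := ev_scaleAbsMonic (normalizeS (trimQ (substQ i num c (2 * ((degIn i p + 1) / 2)) p))) z
    rw [hκ, ev_normalizeS, ev_trimQ, ev_substQ z i num c hz p _ (fun t ht => ?_), mul_comm 2, pow_mul]
    · exact mul_nonneg (by exact_mod_cast hκ0.le) (mul_nonneg (sq_nonneg _) hp)
    · have := le_degIn (i : ℕ) p t ht
      omega

end Summit.NavierStokesRegularity.NavierStokesRegularity.Theorems.PoloidalWindowDoorLrcModEntireJetCertPsatzSubst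

end
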